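import Literature.Geometry.Lorentzian.CausalFutureProofs
import Summits.FinalStateConjecture.FinalStateConjecture.Theorems.BartnikGapSettlingBondiBartnikRigidityKillingDomainCausal
import Summits.FinalStateConjecture.FinalStateConjecture.Theorems.BartnikGapSettlingBondiBartnikRigidityFarCompletionDefs
import HarnessLib

/-!
# Far completion (stub K4 `stub_farCompletion`, line `direct-method-on-the-cone`, crux
# `BondiBartnikRigidity`, stmt-FinalStateConjecture-10807): the sorry-free ASSEMBLY

The bookkeeping half of K4, all proved (no new facts), over the vocabulary of
`…FarCompletionDefs.lean`:

* causal bookkeeping on a vacuum Cauchy development — `J⁺(J⁺ A) = J⁺ A`, `J⁺(C) ⊆ J⁺(ι X)` for the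
  core of a collar carried by a typed leaf through `p`;
* star backgrounds — inner radius `r > M`, continuity of the Kerr-star time and radius;
* box ⟹ near zone (`nearZone_of_box`, `IsNearModelBox.*_of_subset`): inside an `(ε₁, k₁)`-box
  `{τ < t* < τ + T, M < r < R + 1}` the recentred near-zone LAYER `{−1 < t* − s < 1, r < R₁ + 1}`
  (`[s − 1, s + 1] ⊆ [τ, τ + T]`, `R₁ ≤ R`) inherits smoothness, the open-embedding property, the image
  clause and the LAYER certification (`k ≤ k₁`, `ε₁ ≤ ε`) — the hole-chart half of a sound leaf;
* the ASSEMBLY THEOREM `isSoundNearKerrLeaf_of_nearZone_of_farChart` / `…_of_box_of_farChart`: a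
  near-zone chart (resp. a box) of the star background of the recentred motion + a far chart
  (`IsFarChart`, eleven clauses) ⟹ `S' = sheet ∪ disc` is a SOUND `(ε, k)`-near-Kerr leaf with the hole
  `(M, a)` and `S' ⊆ J⁺(C)`; all 25 clauses of `CauchyDevelopment.IsSoundNearKerrLeaf` are discharged.

Registered bookkeeping sub-goal (anchor): `stub_soundLeafOfBoxAndFarChart`, the universe-`0` closed form
of `isSoundNearKerrLeaf_of_box_of_farChart`.  The far chart itself is the analytic content (F2ʳ,
`FarHyperboloidalCompletionRest`, Defs file); the reduction of the registered stub is
`…FarCompletionReduction.lean`.  First version by worker K4 of lead a2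
(`Cruxes/…/Lines/direct_method_on_the_cone_K4.lean`), generalised here to an abstract recentred
background (so that the spatial translation of the reduction composes).

References: DHRT arXiv:2104.08222, §1 [DafermosHolzegelRodnianskiTaylor2021]; O'Neill 1983, Ch. 14,
p. 402 [ONeillSemiRiemannian1983]; Dafermos–Rodnianski arXiv:0811.0354, §5.1 [DafermosRodnianski2008].
-/

noncomputable section

-- D-0017: single-problem summit, `Summit.<S>.<S>.…` by design (cf. lakefile `weak.linter.dupNamespace`).
set_option linter.dupNamespace false
-- instance search through the nested operator types of the Kerr chart facts
set_option maxSynthPendingDepth 3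

open Set Filter Function Topology TopologicalSpace
open Literature.Geometry.Lorentzian
open scoped Manifold ContDiff Topology ENNReal

namespace Summit.FinalStateConjecture.FinalStateConjecture.Theorems.BondiBartnikRigidity.DirectMethod

universe u


/-! ### Causal bookkeeping on a Cauchy development -/

section Causal

variable {X : Type u} [TopologicalSpace X] [ChartedSpace E3 X] [IsManifold (𝓡 3) ∞ X]
  [ConnectedSpace X] {D : InitialDataSet (𝓡 3) X}

/-- `J⁺(J⁺(A)) = J⁺(A)` in a vacuum Cauchy development (boundaryless `C^∞` carrier;
`LorentzianMetric.causalFuture_causalFuture_eq`). O'Neill 1983, Ch. 14, p. 402.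
[cite: ONeillSemiRiemannian1983, Ch. 14, p. 402] -/
theorem causalFuture_causalFuture (𝒟 : VacuumCauchyDevelopment D) (A : Set 𝒟.carrier) :
    𝒟.metric.causalFuture 𝒟.timeOrientation (𝒟.metric.causalFuture 𝒟.timeOrientation A) =
      𝒟.metric.causalFuture 𝒟.timeOrientation A :=
  LorentzianMetric.causalFuture_causalFuture_eq
    (WithTop.coe_le_coe.mpr le_top : (2 : ℕ∞ω) ≤ ((⊤ : ℕ∞) : ℕ∞ω)) A

/-- A set inside `J⁺(A')` with `A' ⊆ J⁺(A)` is inside `J⁺(A)` (monotonicity and idempotence of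
`J⁺`). O'Neill 1983, Ch. 14, p. 402. [cite: ONeillSemiRiemannian1983, Ch. 14, p. 402] -/
theorem subset_causalFuture_of_subset (𝒟 : VacuumCauchyDevelopment D) {A A' S' : Set 𝒟.carrier}
    (hA' : A' ⊆ 𝒟.metric.causalFuture 𝒟.timeOrientation A)
    (hS' : S' ⊆ 𝒟.metric.causalFuture 𝒟.timeOrientation A') :
    S' ⊆ 𝒟.metric.causalFuture 𝒟.timeOrientation A :=
  (hS'.trans (LorentzianMetric.causalFuture_mono hA')).trans (causalFuture_causalFuture 𝒟 A).le

/-- The core of a thick collar carried by a typed leaf through `p` lies to the causal future of the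
data hypersurface, hence so does its causal future: `J⁺(C) ⊆ J⁺(ι X)` (`C ⊆ S ⊆ J⁺(ι X)` by
`IsNearKerrLeaf.subset_causalFuture`, then idempotence).
[cite: ONeillSemiRiemannian1983, Ch. 14, p. 402] -/
theorem causalFuture_collarCore_subset {𝒟 : VacuumCauchyDevelopment D} {k : ℕ} {ε : ℝ≥0∞} {N N' : ℕ}
    {M' a' : Fin N' → ℝ} {S : Set 𝒟.carrier} {M : Fin N → ℝ} {p : 𝒟.carrier}
    {B : Fin N → ModelBackground} {Φ : ∀ i, (B i).domain → 𝒟.carrier}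
    (hleaf : 𝒟.toCauchyDevelopment.IsNearKerrLeaf k ε N' M' a' S) (hp : p ∈ S)
    (hΦ : ∀ i, Φ i '' (B i).truncTimeSlab (3 * M i) 0 ⊆ S) :
    𝒟.metric.causalFuture 𝒟.timeOrientation (collarCore M p B Φ) ⊆
      𝒟.metric.causalFuture 𝒟.timeOrientation (range 𝒟.embed) :=
  (LorentzianMetric.causalFuture_mono
    ((collarCore_subset M p B Φ hp hΦ).trans hleaf.subset_causalFuture)).trans
    (causalFuture_causalFuture 𝒟 _).le

end Causal

/-! ### Star backgrounds: inner radius and continuity of the coordinate functions -/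

section Star

variable {B : ModelBackground} {Λ : lorentzGroup} {c : E4} {M a : ℝ}

/-- On the boosted star background the Kerr–Schild radius exceeds the inner radius `M`
(the domain is `{max M 0 < r}`; DR arXiv:0811.0354, §5.1). [cite: DafermosRodnianski2008, §5.1] -/
theorem lt_radius_of_eq_starBackground
    (hB : B = starBackground Λ c M a fun x => Kerr.radius a (poincareInv Λ c x)) (x : B.domain) :
    M < B.radius x.1 := by
  subst hB
  exact Kerr.lt_radius_of_mem_region x.2

/-- The Kerr-star time of a boosted star background is continuous. [folklore] -/
theorem continuous_time_of_eq_starBackground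
    (hB : B = starBackground Λ c M a fun x => Kerr.radius a (poincareInv Λ c x)) :
    Continuous B.time := by
  subst hB
  exact continuous_time_starBackground Λ c M a _

/-- The Kerr–Schild radius of a boosted star background is continuous. [folklore] -/
theorem continuous_radius_of_eq_starBackground
    (hB : B = starBackground Λ c M a fun x => Kerr.radius a (poincareInv Λ c x)) :
    Continuous B.radius := by
  subst hB
  exact continuous_radius_starBackground Λ c M a

end Star

/-! ### From a box to the near-zone layer of the recentred background -/

section BoxToLayer

variable {𝒮 : Spacetime.{u} 4} {B : ModelBackground} {k : ℕ} {ε : ℝ≥0∞} {τ₁ τ₂ r₁ r₂ s R₁ : ℝ}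
  {J : Set 𝒮.carrier} {Ψ : B.domain → 𝒮.carrier}

/-- A recentred near-zone layer of truncation radius `R₁` lies in the box
`{τ₁ < t < τ₂, r₁ < r < r₂}` as soon as `τ₁ ≤ s − 1`, `s + 1 ≤ τ₂`, `R₁ + 1 ≤ r₂` and `r > r₁` on the
whole domain (for the star background: `r > M`). [folklore] -/
theorem nearLayer_shiftTime_subset_coordBox (hs₁ : τ₁ ≤ s - 1) (hs₂ : s + 1 ≤ τ₂)
    (hR₁ : R₁ + 1 ≤ r₂) (hdom : ∀ x : B.domain, r₁ < B.radius x.1) :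
    nearLayer (shiftTime B s) R₁ ⊆ coordBox B τ₁ τ₂ r₁ r₂ := by
  intro x hx
  simp only [nearLayer, mem_setOf_eq] at hx
  exact ⟨by linarith [hx.1], by linarith [hx.2.1], hdom x, hx.2.2.trans_le hR₁⟩

/-- The upper near-zone layer lies in the truncated near-zone layer. [folklore] -/
theorem nearUpper_subset_nearLayer (B : ModelBackground) (R₁ : ℝ) :
    nearUpper B R₁ ⊆ {x | x ∈ nearLayer B R₁ ∧ B.radius x.1 ≤ R₁} :=
  fun _ hx ↦ ⟨⟨by linarith [hx.1], hx.2.1, by linarith [hx.2.2]⟩, hx.2.2⟩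

/-- The near-zone layer is open when the time and radius functions are continuous. [folklore] -/
theorem isOpen_nearLayer (hBt : Continuous B.time) (hBr : Continuous B.radius) (R₁ : ℝ) :
    IsOpen (nearLayer B R₁) := by
  have ht : Continuous fun x : B.domain => B.time x.1 := hBt.comp continuous_subtype_val
  have hr : Continuous fun x : B.domain => B.radius x.1 := hBr.comp continuous_subtype_val
  exact (isOpen_lt continuous_const ht).inter
    ((isOpen_lt ht continuous_const).inter (isOpen_lt hr continuous_const))

/-- The near-zone layer of the time-shifted background is open (same hypotheses). [folklore] -/
theorem isOpen_nearLayer_shiftTime (hBt : Continuous B.time) (hBr : Continuous B.radius) (s R₁ : ℝ) :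
    IsOpen (nearLayer (shiftTime B s) R₁) :=
  isOpen_nearLayer (B := shiftTime B s) (hBt.sub continuous_const) hBr R₁

namespace IsNearModelBox

variable (hbox : IsNearModelBox 𝒮 B k ε τ₁ τ₂ r₁ r₂ J Ψ)
include hbox

/-- The chart of a box is smooth on every subset of the box. [folklore] -/
theorem contMDiffOn_of_subset {L : Set B.domain} (hL : L ⊆ coordBox B τ₁ τ₂ r₁ r₂) :
    ContMDiffOn 𝓘(ℝ, E4) (𝓡 4) ∞ Ψ L :=
  hbox.contMDiffOn.mono hL

/-- The chart of a box is an open embedding of every OPEN subset of the box (restriction of an open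
embedding along the open inclusion). [folklore] -/
theorem isOpenEmbedding_of_subset {L : Set B.domain} (hL : L ⊆ coordBox B τ₁ τ₂ r₁ r₂)
    (hLo : IsOpen L) : IsOpenEmbedding (L.restrict Ψ) :=
  hbox.isOpenEmbedding.comp (IsOpenEmbedding.inclusion hL (hLo.preimage continuous_subtype_val))

/-- The image of every subset of a box inside `J` lies in `J`. [folklore] -/
theorem image_subset_of_subset {L : Set B.domain} (hL : L ⊆ coordBox B τ₁ τ₂ r₁ r₂) :
    Ψ '' L ⊆ J :=
  (image_mono hL).trans hbox.image_subset

/-- The `Cᵏ` deviation over every subset of an `(ε, k)`-box is `≤ ε`. [folklore] -/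
theorem supCkENorm_le_of_subset {A : Set B.domain} (hA : A ⊆ coordBox B τ₁ τ₂ r₁ r₂) :
    supCkENorm (Subtype.val '' A) k (𝒮.deviationExtend B Ψ) ≤ ε :=
  (supCkENorm_mono (image_mono hA) _ _).trans hbox.supCkENorm_le

end IsNearModelBox

end BoxToLayer

/-! ### Assembly: near zone + far chart give a sound leaf inside `J⁺(C)`; the box gives the near zone -/

section Assembly

variable {X : Type u} [TopologicalSpace X] [ChartedSpace E3 X] [IsManifold (𝓡 3) ∞ X]
  [ConnectedSpace X] {D : InitialDataSet (𝓡 3) X}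

/-- **ASSEMBLY THEOREM (the bookkeeping half of K4, sorry-free).** In a vacuum Cauchy development let
`B' = starBackground Λ' c' M a r'` be a boosted Kerr star background with `0 < M`, `|a| ≤ M`, let
`Ψ : B'.domain → 𝒟` be a NEAR-ZONE chart of truncation radius `R₁ ≥ 2M` — smooth on the near-zone
layer `L = {−1 < t' < 1, r < R₁ + 1}`, an open embedding of it with image in `J⁺(ι X)`, `Cᵏ`-certified
(`≤ ε`) on the truncated layer `{x ∈ L | r ≤ R₁}`, with the disc `{t' = 0, r ≤ R₁}` inside `J⁺(C)` —
and let a FAR CHART `(U₀, Ψ₀)` relative to it with overlap radii `0 < ρ < R₁` be given (`IsFarChart`).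
THEN `S' = Ψ₀{t₀ = 0} ∪ Ψ{t' = 0, r ≤ R₁}` is a SOUND `(ε, k)`-near-Kerr leaf with the single hole
`(M, a)` and `S' ⊆ J⁺(C)`: all 25 clauses of `CauchyDevelopment.IsSoundNearKerrLeaf` are discharged
by bookkeeping (hole layer = `L`, flat layer = `{−1 < t₀ < 1}`; the slab certifications follow from the
layer certifications). [cite: DafermosHolzegelRodnianskiTaylor2021, §1] -/
theorem isSoundNearKerrLeaf_of_nearZone_of_farChart (𝒟 : VacuumCauchyDevelopment D) {k : ℕ}
    {ε : ℝ≥0∞} {M a : Fin 1 → ℝ} {mo' : lorentzGroup × E4} {B' : ModelBackground}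
    {C : Set 𝒟.carrier} {R₁ ρ : ℝ} {Ψ : B'.domain → 𝒟.carrier} {U₀ : Opens E4}
    {Ψ₀ : (hypBackground U₀).domain → 𝒟.carrier}
    (hM : 0 < M 0) (ha : |a 0| ≤ M 0) (hρ : 0 < ρ) (hρR : ρ < R₁) (h2M : 2 * M 0 ≤ R₁)
    (hB' : B' = starBackground mo'.1 mo'.2 (M 0) (a 0)
      fun x => Kerr.radius (a 0) (poincareInv mo'.1 mo'.2 x))
    (hΨs : ContMDiffOn 𝓘(ℝ, E4) (𝓡 4) ∞ Ψ (nearLayer B' R₁))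
    (hΨe : IsOpenEmbedding ((nearLayer B' R₁).restrict Ψ))
    (hΨJ : Ψ '' nearLayer B' R₁ ⊆ 𝒟.metric.causalFuture 𝒟.timeOrientation (range 𝒟.embed))
    (hΨlayer : supCkENorm (Subtype.val '' {x | x ∈ nearLayer B' R₁ ∧ B'.radius x.1 ≤ R₁}) k
      (𝒟.toSpacetime.deviationExtend B' Ψ) ≤ ε)
    (hΨC : Ψ '' B'.truncTimeSlab R₁ 0 ⊆ 𝒟.metric.causalFuture 𝒟.timeOrientation C)
    (hfar : IsFarChart 𝒟 k ε (a 0) mo' B' Ψ C R₁ ρ U₀ Ψ₀) :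
    𝒟.toCauchyDevelopment.IsSoundNearKerrLeaf k ε 1 M a
        (Ψ₀ '' (hypBackground U₀).timeSlab 0 ∪ Ψ '' B'.truncTimeSlab R₁ 0) ∧
      Ψ₀ '' (hypBackground U₀).timeSlab 0 ∪ Ψ '' B'.truncTimeSlab R₁ 0 ⊆
        𝒟.metric.causalFuture 𝒟.timeOrientation C := by
  obtain ⟨hU₀, hΨ₀, hΨ₀e, hΨ₀J, hΨ₀layer, hover₁, hover₀, hW, hbar, hach, hsheet⟩ := hfar
  -- the flat slab sits in the flat layer
  have hslab₀ : (hypBackground U₀).timeSlab 0 ⊆ flatLayer U₀ := by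
    intro x hx
    rw [ModelBackground.mem_timeSlab] at hx
    simp only [flatLayer, mem_setOf_eq, hx]
    norm_num
  have hslab : B'.truncTimeSlab R₁ 0 ⊆ {x | x ∈ nearLayer B' R₁ ∧ B'.radius x.1 ≤ R₁} :=
    stub_discInNearZoneLayer B' R₁
  refine ⟨⟨fun _ => R₁, fun _ => ρ, fun _ => mo',
    fun i => fun x => Kerr.radius (a i) (poincareInv mo'.1 mo'.2 x),
    fun _ => B', U₀, hypBackground U₀, fun _ => Ψ, Ψ₀,
    fun _ => nearLayer B' R₁, fun _ => nearUpper B' R₁,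
    flatLayer U₀, flatUpper U₀, fun i => rfl, ?_, rfl, fun i => ⟨rfl, rfl⟩, rfl, rfl, ?_, ?_, ?_,
    hΨ₀, hΨ₀e, hΨ₀J, ?_, ?_, Subsingleton.pairwise, ?_, ?_, ?_, ?_, ?_, ?_, ?_, hΨ₀layer,
    Subsingleton.pairwise, hach⟩, ?_⟩
  · -- (2) the hole background is the star background of `mo'`
    intro i
    obtain rfl : i = 0 := Fin.fin_one_eq_zero i
    exact hB'
  · -- (7) labels and radii
    intro i
    obtain rfl : i = 0 := Fin.fin_one_eq_zero i
    exact ⟨hM, ha, hρ, hρR⟩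
  · -- (8) the flat domain contains `{t₀ > −1, r' > ρ}`
    intro x hx
    exact hU₀ ⟨hx.1, hx.2 0⟩
  · -- (9) hole chart: smooth, open embedding, image in `J⁺(ι X)` on the near-zone layer
    intro i
    exact ⟨hΨs, hΨe, hΨJ⟩
  · -- (13) slab certification of the hole chart (from the layer certification)
    intro i
    exact (supCkENorm_mono (image_mono hslab) _ _).trans hΨlayer
  · -- (14) slab certification of the flat chart (from the layer certification)
    exact (supCkENorm_mono (image_mono hslab₀) _ _).trans hΨ₀layer
  · -- (16) hole annulus charted by the flat layer
    intro i
    exact hover₁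
  · -- (17) flat annulus charted by the hole layer
    intro i
    obtain rfl : i = 0 := Fin.fin_one_eq_zero i
    exact hover₀
  · -- (18) the leaf is sheet ∪ disc
    rw [iUnion_const]
  · -- (19) upper layers in `I⁺(S')`
    rw [iUnion_const]
    exact hW
  · -- (20) barrier clause
    rw [iUnion_const]
    exact hbar
  · -- (S₁) thick honest disc
    intro i
    obtain rfl : i = 0 := Fin.fin_one_eq_zero i
    exact h2M
  · -- (S₂) near-zone LAYER certification of the hole chart
    intro i
    exact hΨlayer
  · -- `S' ⊆ J⁺(C)`: the sheet by (F5), the disc by hypothesis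
    exact union_subset hsheet hΨC

/-- **From a box to the near zone of the recentred background.** If `Ψ` is an `(ε₁, k₁)`-box
`{τ < t* < τ + T, M < r < R + 1}` of the boosted Kerr star background `B₁ = starBackground Λ c M a r`
inside `J⁺(C) ⊆ J⁺(ι X)`, and `τ ≤ s − 1`, `s + 1 ≤ τ + T`, `R₁ ≤ R`, `k ≤ k₁`, `ε₁ ≤ ε`, then `Ψ` is a
near-zone chart of truncation radius `R₁` of the time-shifted background `shiftTime B₁ s` in the sense
consumed by `isSoundNearKerrLeaf_of_nearZone_of_farChart` (the recentred layer
`{−1 < t* − s < 1, r < R₁ + 1}` sits in the box since `r > M` on the star region; the deviation does not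
see the time shift). [cite: DafermosHolzegelRodnianskiTaylor2021, §1] -/
theorem nearZone_of_box (𝒟 : VacuumCauchyDevelopment D) {k k₁ : ℕ} {ε ε₁ : ℝ≥0∞} {M a : ℝ}
    {Λ : lorentzGroup} {c : E4} {B₁ : ModelBackground} {C : Set 𝒟.carrier} {τ T R s R₁ : ℝ}
    {Ψ : B₁.domain → 𝒟.carrier}
    (hB₁ : B₁ = starBackground Λ c M a fun x => Kerr.radius a (poincareInv Λ c x))
    (hC : 𝒟.metric.causalFuture 𝒟.timeOrientation C ⊆
      𝒟.metric.causalFuture 𝒟.timeOrientation (range 𝒟.embed))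
    (hbox : IsNearModelBox 𝒟.toSpacetime B₁ k₁ ε₁ τ (τ + T) M (R + 1)
      (𝒟.metric.causalFuture 𝒟.timeOrientation C) Ψ)
    (hk : k ≤ k₁) (hε : ε₁ ≤ ε) (hs₁ : τ ≤ s - 1) (hs₂ : s + 1 ≤ τ + T) (hR₁ : R₁ ≤ R) :
    ContMDiffOn 𝓘(ℝ, E4) (𝓡 4) ∞ Ψ (nearLayer (shiftTime B₁ s) R₁) ∧
    IsOpenEmbedding ((nearLayer (shiftTime B₁ s) R₁).restrict Ψ) ∧
    Ψ '' nearLayer (shiftTime B₁ s) R₁ ⊆ 𝒟.metric.causalFuture 𝒟.timeOrientation (range 𝒟.embed) ∧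
    supCkENorm (Subtype.val '' {x | x ∈ nearLayer (shiftTime B₁ s) R₁ ∧
        (shiftTime B₁ s).radius x.1 ≤ R₁}) k (𝒟.toSpacetime.deviationExtend (shiftTime B₁ s) Ψ) ≤ ε ∧
    Ψ '' (shiftTime B₁ s).truncTimeSlab R₁ 0 ⊆ 𝒟.metric.causalFuture 𝒟.timeOrientation C := by
  -- the star background: inner radius and continuity
  have hdom : ∀ x : B₁.domain, M < B₁.radius x.1 := lt_radius_of_eq_starBackground hB₁
  have hBt : Continuous B₁.time := continuous_time_of_eq_starBackground hB₁
  have hBr : Continuous B₁.radius := continuous_radius_of_eq_starBackground hB₁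
  -- the recentred layer sits in the box
  have hL : nearLayer (shiftTime B₁ s) R₁ ⊆ coordBox B₁ τ (τ + T) M (R + 1) :=
    nearLayer_shiftTime_subset_coordBox hs₁ hs₂ (by linarith) hdom
  have hLo : IsOpen (nearLayer (shiftTime B₁ s) R₁) := isOpen_nearLayer_shiftTime hBt hBr s R₁
  have htrunc : {x | x ∈ nearLayer (shiftTime B₁ s) R₁ ∧ (shiftTime B₁ s).radius x.1 ≤ R₁} ⊆
      coordBox B₁ τ (τ + T) M (R + 1) := fun x hx ↦ hL hx.1
  have hslab : (shiftTime B₁ s).truncTimeSlab R₁ 0 ⊆ coordBox B₁ τ (τ + T) M (R + 1) :=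
    fun x hx ↦ htrunc (stub_discInNearZoneLayer (shiftTime B₁ s) R₁ hx)
  refine ⟨hbox.contMDiffOn_of_subset hL, hbox.isOpenEmbedding_of_subset hL hLo,
    (hbox.image_subset_of_subset hL).trans hC, ?_, hbox.image_subset_of_subset hslab⟩
  rw [deviationExtend_shiftTime]
  exact ((supCkENorm_mono_right _ hk _).trans (hbox.supCkENorm_le_of_subset htrunc)).trans hε

/-- **Box + far chart ⟹ sound leaf inside `J⁺(C)`** (composition of `nearZone_of_box` and
`isSoundNearKerrLeaf_of_nearZone_of_farChart`): for an `(ε₁, k₁)`-box of `B₁ = starBackground Λ c M a r`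
inside `J⁺(C) ⊆ J⁺(ι X)` with `k ≤ k₁`, `ε₁ ≤ ε`, a recentring time `s`, radii `0 < ρ < R₁`,
`2M ≤ R₁ ≤ R`, the recentring identity `shiftTime B₁ s = starBackground mo' …`, and a far chart relative
to the recentred chart, the union of the flat sheet and the box's slab `{t* = s, r ≤ R₁}` is a SOUND
`(ε, k)`-leaf with hole `(M, a)` inside `J⁺(C)`. [cite: DafermosHolzegelRodnianskiTaylor2021, §1] -/
theorem isSoundNearKerrLeaf_of_box_of_farChart (𝒟 : VacuumCauchyDevelopment D) {k k₁ : ℕ}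
    {ε ε₁ : ℝ≥0∞} {M a : Fin 1 → ℝ} {Λ : lorentzGroup} {c : E4} {mo' : lorentzGroup × E4}
    {B₁ : ModelBackground} {C : Set 𝒟.carrier} {τ T R s R₁ ρ : ℝ} {Ψ : B₁.domain → 𝒟.carrier}
    {U₀ : Opens E4} {Ψ₀ : (hypBackground U₀).domain → 𝒟.carrier}
    (hM : 0 < M 0) (ha : |a 0| ≤ M 0)
    (hB₁ : B₁ = starBackground Λ c (M 0) (a 0) fun x => Kerr.radius (a 0) (poincareInv Λ c x))
    (hB' : shiftTime B₁ s = starBackground mo'.1 mo'.2 (M 0) (a 0)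
      fun x => Kerr.radius (a 0) (poincareInv mo'.1 mo'.2 x))
    (hC : 𝒟.metric.causalFuture 𝒟.timeOrientation C ⊆
      𝒟.metric.causalFuture 𝒟.timeOrientation (range 𝒟.embed))
    (hbox : IsNearModelBox 𝒟.toSpacetime B₁ k₁ ε₁ τ (τ + T) (M 0) (R + 1)
      (𝒟.metric.causalFuture 𝒟.timeOrientation C) Ψ)
    (hk : k ≤ k₁) (hε : ε₁ ≤ ε) (hs₁ : τ ≤ s - 1) (hs₂ : s + 1 ≤ τ + T) (hρ : 0 < ρ) (hρR : ρ < R₁)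
    (h2M : 2 * M 0 ≤ R₁) (hR₁ : R₁ ≤ R)
    (hfar : IsFarChart 𝒟 k ε (a 0) mo' (shiftTime B₁ s) Ψ C R₁ ρ U₀ Ψ₀) :
    𝒟.toCauchyDevelopment.IsSoundNearKerrLeaf k ε 1 M a
        (Ψ₀ '' (hypBackground U₀).timeSlab 0 ∪ Ψ '' (shiftTime B₁ s).truncTimeSlab R₁ 0) ∧
      Ψ₀ '' (hypBackground U₀).timeSlab 0 ∪ Ψ '' (shiftTime B₁ s).truncTimeSlab R₁ 0 ⊆
        𝒟.metric.causalFuture 𝒟.timeOrientation C := by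
  obtain ⟨hΨs, hΨe, hΨJ, hΨlayer, hΨC⟩ := nearZone_of_box 𝒟 hB₁ hC hbox hk hε hs₁ hs₂ hR₁
  exact isSoundNearKerrLeaf_of_nearZone_of_farChart 𝒟 hM ha hρ hρR h2M hB' hΨs hΨe hΨJ hΨlayer hΨC
    hfar

end Assembly


/-! ### Registered bookkeeping sub-goal (the anchor of this file) -/

section Anchor

/-- **Registered bookkeeping sub-goal of the line** (`stub_soundLeafOfBoxAndFarChart`, brick for
`stub_farCompletion`): the universe-`0` closed form of `isSoundNearKerrLeaf_of_box_of_farChart` — an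
`(ε₁, k₁)`-Kerr box of a collar's star background inside `J⁺(C) ⊆ J⁺(ι X)`, recentred in time, plus a
far chart relative to it, give a SOUND `(ε, k)`-near-Kerr leaf with the hole `(M, a)` inside `J⁺(C)`.
[cite: DafermosHolzegelRodnianskiTaylor2021, §1] -/
theorem stub_soundLeafOfBoxAndFarChart : ∀ (X : Type) [TopologicalSpace X] [ChartedSpace E3 X] [IsManifold (𝓡 3) ∞ X] [T2Space X] [SecondCountableTopology X] [ConnectedSpace X] (D : InitialDataSet (𝓡 3) X) (𝒟 : VacuumCauchyDevelopment D) (k k₁ : ℕ) (ε ε₁ : ℝ≥0∞) (M a : Fin 1 → ℝ) (Λ : lorentzGroup) (c : E4) (mo' : lorentzGroup × E4) (B₁ : ModelBackground) (C : Set 𝒟.carrier) (τ T R s R₁ ρ : ℝ) (Ψ : B₁.domain → 𝒟.carrier) (U₀ : Opens E4) (Ψ₀ : (hypBackground U₀).domain → 𝒟.carrier), 0 < M 0 → |a 0| ≤ M 0 → (B₁ = starBackground Λ c (M 0) (a 0) fun x => Kerr.radius (a 0) (poincareInv Λ c x)) → (shiftTime B₁ s = starBackground mo'.1 mo'.2 (M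 0) (a 0) fun x => Kerr.radius (a 0) (poincareInv mo'.1 mo'.2 x)) → 𝒟.metric.causalFuture 𝒟.timeOrientation C ⊆ 𝒟.metric.causalFuture 𝒟.timeOrientation (range 𝒟.embed) → IsNearModelBox 𝒟.toSpacetime B₁ k₁ ε₁ τ (τ + T) (M 0) (R + 1) (𝒟.metric.causalFuture 𝒟.timeOrientation C) Ψ → k ≤ k₁ → ε₁ ≤ ε → τ ≤ s - 1 → s + 1 ≤ τ + T → 0 < ρ → ρ < R₁ → 2 * M 0 ≤ R₁ → R₁ ≤ R → IsFarChart 𝒟 k ε (a 0) mo' (shiftTime B₁ s) Ψ C R₁ ρ U₀ Ψ₀ → 𝒟.toCauchyDevelopment.IsSoundNearKerrLeaf k ε 1 M a (Ψ₀ '' (hypBackground U₀).timeSlab 0 ∪ Ψ '' (shiftTime B₁ s).truncTimeSlab R₁ 0) ∧ Ψ₀ '' (hypBackground U₀).timeSlab 0 ∪ Ψ '' (shiftTime B₁ s).truncTimeSlab R₁ 0 ⊆ 𝒟.metric.causalFuture 𝒟.timeOrientation C :=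
  fun _ _ _ _ _ _ _ _ 𝒟 _ _ _ _ _ _ _ _ _ _ _ _ _ _ _ _ _ _ _ _ hM ha hB₁ hB' hC hbox hk hε hs₁ hs₂ hρ hρR h2M hR₁
    hfar ↦
  isSoundNearKerrLeaf_of_box_of_farChart 𝒟 hM ha hB₁ hB' hC hbox hk hε hs₁ hs₂ hρ hρR h2M hR₁ hfar

end Anchor

end Summit.FinalStateConjecture.FinalStateConjecture.Theorems.BondiBartnikRigidity.DirectMethod

end
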